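import Literature.NumberTheory.EllipticCurves.KrizLi2019.EisensteinHeegnerLog
import Literature.NumberTheory.EllipticCurves.NonEisensteinPrimeOfSurjective
import Literature.NumberTheory.QuadraticFields.KroneckerSplitting
import Mathlib.NumberTheory.LegendreSymbol.QuadraticReciprocity
import HarnessLib

/-!
# ROUTE U — the Heegner field `K'' = ℚ(√−19)` for `D = −11`: Heegner hypothesis, `7` split, `ε_K`

bsd-cm cell, ROUTE U (Theorem U: BSD(49a1^{(D)}, 7) ⇒ full BSD on `𝒞₇`), `D = −11` (curve of
conductor `5929 = 7²·11²`), Heegner field `K'' = ℚ(√−19)` of the T-U4/T-U5 design. For ANY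
number field `K` with `IsImaginaryQuadratic K` and `d_K = −19` this file discharges the `K`-side
binders of Kriz–Li Thm. 1.20 / ROUTE U T-U5 from the tree's decomposition law for quadratic
fields (`Quadratic.ncard_primesOver_eq_two_iff_legendreSym`, `…_two_eq_two_iff`; Marcus Ch. 3
Thm. 25):

* `7` and `11` split in `K` (`(−19/7) = (−19/11) = 1`): `ncard_primesOver_eq_two_of_discr_eq_neg19`
  — in particular the hypothesis "`p = 7` splits in `K`" (`hsplit`);
* the Heegner hypothesis for every level `N` whose prime factors lie in `{7, 11}`
  (`satisfiesHeegnerHypothesis_of_discr_eq_neg19`), and for the conductor of any `W/ℚ` whose bad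
  primes lie in `{7, 11}` (`satisfiesHeegnerHypothesis_conductorNorm_of_discr_eq_neg19`; the bad
  primes of `49a1^{(−11)}` do, `RouteUTwistReduction`);
* `2` is inert (`d_K ≡ 5 (mod 8)`), so a Kronecker character `ε_K` (level `19 = |d_K|`, values
  `±1` by splitting — the unfolded form of `IsKroneckerCharacterOf K ε_K`) has `ε_K(2) = −1` and,
  `2` generating `(ℤ/19)^×`, **`ε_K(a) = (a/19)` for every `a`** (`kroneckerCharacter_apply_of_discr_eq_neg19`)
  — the hypothesis `hε` of `RouteUBernoulliD11` / `RouteUHBD11` (the Bernoulli certificates);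
* `d_K < −4` and `7 ∤ d_K` (for `hμ`, `hsplit`).

THEOREMS ONLY; no new definitions, no named facts; prime `Fact`s are binders.
-/

noncomputable section

open scoped Classical
open NumberField Literature.NumberTheory.EllipticCurves Literature.NumberTheory.QuadraticFields

namespace Summit.BirchSwinnertonDyer.Rank1Residual.X12.O11.RouteU

variable {K : Type} [Field K] [NumberField K]

/-! ## §1 `(−19/7) = (−19/11) = 1`: `7` and `11` split in `ℚ(√−19)` -/

/-- `−19 = 3² ≠ 0` in `𝔽₇` (kernel computation, no `Fact` in scope). [folklore] -/
private theorem zmod7_neg19_eq : ((-19 : ℤ) : ZMod 7) = 3 * 3 := by decide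

/-- `−19 ≠ 0` in `𝔽₇`. [folklore] -/
private theorem zmod7_neg19_ne : ((-19 : ℤ) : ZMod 7) ≠ 0 := by decide

/-- `−19 = 5² ≠ 0` in `𝔽₁₁`. [folklore] -/
private theorem zmod11_neg19_eq : ((-19 : ℤ) : ZMod 11) = 5 * 5 := by decide

/-- `−19 ≠ 0` in `𝔽₁₁`. [folklore] -/
private theorem zmod11_neg19_ne : ((-19 : ℤ) : ZMod 11) ≠ 0 := by decide

/-- `(−19/7) = 1` (`−19 ≡ 2 = 3² (mod 7)`). [folklore] -/
theorem legendreSym_seven_neg19 [Fact (Nat.Prime 7)] : legendreSym 7 (-19) = 1 :=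
  (legendreSym.eq_one_iff 7 zmod7_neg19_ne).mpr ⟨3, zmod7_neg19_eq⟩

/-- `(−19/11) = 1` (`−19 ≡ 3 = 5² (mod 11)`). [folklore] -/
theorem legendreSym_eleven_neg19 [Fact (Nat.Prime 11)] : legendreSym 11 (-19) = 1 :=
  (legendreSym.eq_one_iff 11 zmod11_neg19_ne).mpr ⟨5, zmod11_neg19_eq⟩

/-- **`7` and `11` split in an imaginary quadratic field of discriminant `−19`.**
[cite: KrizLi2019, Thm. 1.20 (p. 7, "p splits in K") and §1.5] -/
theorem ncard_primesOver_eq_two_of_discr_eq_neg19 (hK : IsImaginaryQuadratic K)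
    (hd : NumberField.discr K = -19) {p : ℕ} (hp : p = 7 ∨ p = 11) :
    ((Ideal.span {(p : ℤ)}).primesOver (𝓞 K)).ncard = 2 := by
  rcases hp with rfl | rfl
  · haveI : Fact (Nat.Prime 7) := ⟨by norm_num⟩
    rw [Quadratic.ncard_primesOver_eq_two_iff_legendreSym hK.1 (by norm_num), hd]
    exact legendreSym_seven_neg19
  · haveI : Fact (Nat.Prime 11) := ⟨by norm_num⟩
    rw [Quadratic.ncard_primesOver_eq_two_iff_legendreSym hK.1 (by norm_num), hd]
    exact legendreSym_eleven_neg19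

/-- **`hsplit` of T-U5 for `K'' = ℚ(√−19)`: `7` splits.** [cite: KrizLi2019, Thm. 1.20 (p. 7)] -/
theorem ncard_primesOver_seven_eq_two_of_discr_eq_neg19 (hK : IsImaginaryQuadratic K)
    (hd : NumberField.discr K = -19) :
    ((Ideal.span {((7 : ℕ) : ℤ)}).primesOver (𝓞 K)).ncard = 2 :=
  ncard_primesOver_eq_two_of_discr_eq_neg19 hK hd (Or.inl rfl)

/-! ## §2 The Heegner hypothesis -/

/-- **Heegner hypothesis for `ℚ(√−19)` at every level supported on `{7, 11}`** (e.g.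
`N = 5929 = 7²·11²`). [cite: GrossLMS1991, §1 (p. 235)] [cite: KrizLi2019, Thm. 1.20 (p. 7)] -/
theorem satisfiesHeegnerHypothesis_of_discr_eq_neg19 (hK : IsImaginaryQuadratic K)
    (hd : NumberField.discr K = -19) {N : ℕ} (hN : ∀ p : ℕ, p.Prime → p ∣ N → p = 7 ∨ p = 11) :
    SatisfiesHeegnerHypothesis N K :=
  fun p hp hpN => ncard_primesOver_eq_two_of_discr_eq_neg19 hK hd (hN p hp hpN)

/-- **Heegner hypothesis for `(N(W), ℚ(√−19))`** for any `W/ℚ` whose primes of bad reduction lie in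
`{7, 11}` (a prime dividing the conductor is bad, tree
`not_dvd_conductorNorm_of_hasGoodReductionAtPrime`). For `W` a model of `49a1^{(−11)}` the
hypothesis is `RouteUTwistReduction.eq_eleven_of_not_hasGoodReductionAtPrime_twist_cm7_D11`.
[cite: GrossLMS1991, §1 (p. 235)] [cite: Silverman1994, IV.10.2(a)] -/
theorem satisfiesHeegnerHypothesis_conductorNorm_of_discr_eq_neg19 (hK : IsImaginaryQuadratic K)
    (hd : NumberField.discr K = -19) (W : WeierstrassCurve ℚ) [W.IsElliptic]
    (hbad : ∀ p : ℕ, (hp : p.Prime) → p ≠ 7 →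
      ¬ (haveI := Fact.mk hp; W.HasGoodReductionAtPrime p) → p = 11) :
    SatisfiesHeegnerHypothesis (W.conductorNorm ℤ) K := by
  refine satisfiesHeegnerHypothesis_of_discr_eq_neg19 hK hd fun p hp hpN => ?_
  by_cases h7 : p = 7
  · exact Or.inl h7
  · right
    haveI := Fact.mk hp
    refine hbad p hp h7 fun hgood => ?_
    exact not_dvd_conductorNorm_of_hasGoodReductionAtPrime W hgood hpN

/-! ## §3 `d_K < −4`, `7 ∤ d_K` -/

/-- `d_K = −19 < −4` (so `w_K = 2`, `hμ`). [folklore] -/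
theorem discr_lt_neg_four_of_discr_eq_neg19 (hd : NumberField.discr K = -19) :
    NumberField.discr K < -4 := by
  rw [hd]; norm_num

/-- `7 ∤ d_K = −19`. [folklore] -/
theorem not_seven_dvd_discr_of_discr_eq_neg19 (hd : NumberField.discr K = -19) :
    ¬ (7 : ℤ) ∣ NumberField.discr K := by
  rw [hd]; decide

/-- `|d_K| = 19`. [folklore] -/
theorem natAbs_discr_of_discr_eq_neg19 (hd : NumberField.discr K = -19) :
    (NumberField.discr K).natAbs = 19 := by
  rw [hd]; rfl

/-! ## §4 The Kronecker character of `ℚ(√−19)` is the Legendre character mod `19` -/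

/-- **`2` is inert in `ℚ(√−19)`** (`d_K = −19 ≡ 5 (mod 8)`; decomposition law at `2`).
[folklore] -/
theorem ncard_primesOver_two_ne_two_of_discr_eq_neg19 (hK : IsImaginaryQuadratic K)
    (hd : NumberField.discr K = -19) :
    ((Ideal.span {(2 : ℤ)}).primesOver (𝓞 K)).ncard ≠ 2 := by
  rw [Ne, Quadratic.ncard_primesOver_two_eq_two_iff hK.1, hd]
  decide

/-- `2` generates `(ℤ/19)^×`: every non-zero residue is a power of `2`. [folklore] -/
theorem exists_pow_two_eq_zmod19 (x : ZMod 19) (hx : x ≠ 0) : ∃ k : Fin 18, x = 2 ^ (k : ℕ) := by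
  revert x
  decide

/-- `(2/19) = −1`. [folklore] -/
theorem legendreSym_nineteen_two [Fact (Nat.Prime 19)] : legendreSym 19 2 = -1 := by
  rw [legendreSym.at_two (by norm_num)]
  decide

/-- **The Kronecker character of `ℚ(√−19)` is `(·/19)`.** If `ε` is a `ℚ₇`-valued character mod
`19 = |d_K|` whose value at every prime `ℓ ∤ d_K` is `+1` if `ℓ` splits in `K` and `−1` otherwise
(the defining clause of `IsKroneckerCharacterOf K ε`, level rewritten to `19`), then
`ε(a) = (a/19)` for every natural number `a`: `ε(2) = −1 = (2/19)` since `2` is inert, and `2`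
generates `(ℤ/19)^×`. (Quadratic reciprocity in disguise: `(−19/ℓ) = (ℓ/19)`.)
[cite: KrizLi2019, §2 (p. 12, "ε_K the quadratic character associated with K")]
[cite: Washington1997, Ch. 3 (quadratic characters and quadratic fields)] -/
theorem kroneckerCharacter_apply_of_discr_eq_neg19 [Fact (Nat.Prime 7)] [Fact (Nat.Prime 19)]
    (hK : IsImaginaryQuadratic K) (hd : NumberField.discr K = -19)
    (ε : DirichletCharacter ℚ_[7] 19)
    (hval : ∀ ℓ : ℕ, ℓ.Prime → ¬ ((ℓ : ℤ) ∣ NumberField.discr K) →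
      ε (ℓ : ZMod 19) = if ((Ideal.span {(ℓ : ℤ)}).primesOver (𝓞 K)).ncard = 2 then 1 else -1)
    (a : ℕ) : ε (a : ZMod 19) = (legendreSym 19 (a : ℤ) : ℚ_[7]) := by
  -- `ε(2) = −1`
  have h2 : ε (2 : ZMod 19) = -1 := by
    have h := hval 2 Nat.prime_two (by rw [hd]; decide)
    rw [if_neg (by exact_mod_cast ncard_primesOver_two_ne_two_of_discr_eq_neg19 hK hd)] at h
    simpa using h
  by_cases h19 : (a : ZMod 19) = 0
  · -- both sides vanish
    rw [h19, MulChar.map_zero, (legendreSym.eq_zero_iff 19 (a : ℤ)).mpr (by exact_mod_cast h19),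
      Int.cast_zero]
  · obtain ⟨k, hk⟩ := exists_pow_two_eq_zmod19 (a : ZMod 19) h19
    -- left: `ε(2^k) = (−1)^k`
    rw [hk, map_pow, h2]
    -- right: `(a/19) = (2/19)^k = (−1)^k` through the quadratic character of `𝔽₁₉`
    have hleg : legendreSym 19 (a : ℤ) = (-1) ^ (k : ℕ) := by
      have e1 : legendreSym 19 (a : ℤ) = quadraticChar (ZMod 19) ((a : ℤ) : ZMod 19) := rfl
      have e2 : legendreSym 19 2 = quadraticChar (ZMod 19) (2 : ZMod 19) := by
        simp [legendreSym]
      rw [e1, Int.cast_natCast, hk, map_pow, ← e2, legendreSym_nineteen_two]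
    rw [hleg]
    push_cast
    rfl

end Summit.BirchSwinnertonDyer.Rank1Residual.X12.O11.RouteU

end
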